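import Summits.QuantumFields.BalabanUV.Beta.PolarizationComposite

/-!
# `BalabanUV.Beta.PolarizationFubini` — binder row D1, route (O3): the FUBINI hypothesis of `PolarizationComposite` from a
# DETERMINANT FACTORISATION of the bordered matrices (the shape of an5's `SliceComposition.det_kkt_comp_slice`), and
# TADPOLE-FREENESS from INVARIANCE (no invariant covector ⟹ no first jet)
# (β sub-cell, BINDER-OWNERS row D1 OWNER, lineage an2 gen 23; sequel of K-U2b p237430)

HONEST FRAMING (cell charter, verbatim): «discharging BetaPertH makes Balaban's UV stability UNCONDITIONAL — a real
constructive-QFT result; it is NOT the continuum limit and NOT the Clay problem.»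
HONEST DEPENDENCY: continuum YM on T⁴ ⇐ BetaPertH ∧ nine spine estimates (0/9 proved); BetaPertH ⇐ (D1) ∧ (D4) ∧ CAP+tail;
G-an2-4 gates asym, D1 and NE2/3/4.
ABSOLUTE RULE (cell, verbatim): «No internally-minted statement may enter as a cited fact. Every hypothesis is either kernel-proved in this
package or a verbatim quotation of a PUBLISHED theorem with page reference. The manuscript(s) under audit are NOT citable for their own
disputed steps — they are the thing under adjudication; programme-internal (2001/route/tribunal) claims are never citable.»
NOTHING below is cited: no `[cite: …]`, no `def`, no `Prop` fact.  Every declaration is [folklore] (real logarithms of products, Mathlib `fderiv` of a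
composition with a continuous linear map, `Family.logZ` ∕ `polarization` BY NAME, K-U2b's `polarization_comp_eq`).  It asserts nothing about Bałaban's
objects; the determinant factorisation, the factoring of the fine data through the step minimiser, and the invariance group are HYPOTHESES.

WHY (row-D1 owner, gen 23; ROUTE (O3), `BETA/AN2.md` §51.4, GAPS C-an2-78 items (O3-a)∕(O3-c)).  K-U2b (`PolarizationComposite`) telescopes the one-loop
polarizations GIVEN the Fubini hypothesis «`F₂.logZ = F₁.logZ ∘ U + Fs.logZ + const` near the trivial background».  On a finite volume that hypothesis is
nothing but the LOGARITHM of a determinant factorisation `det kkt₂(B) = s · det kkt₁(B) · det kkt_s(B)` holding for every background `B` near `0` — exactly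
the shape an5 proved at FIXED matrices for the composed slice (`SliceComposition.det_kkt_comp_slice`: `det kkt(K,[Q₂Q₁;τ̃]) = (−1)^{|μ|}·det kkt(K,[Q₁;τ₁])·
det kkt(𝒮₁₁,[Q₂;τ₂])`; with unipotent slices also `det_kkt_comp_sliceChange_of_unipotent`) — together with the statement that the fine one-shot data
depend on the coarse background only THROUGH the step minimiser (`G.logZ = F₁.logZ ∘ U`).  §1–§2 make that reduction a theorem; §3 types the symmetry
mechanism behind tadpole-freeness: a functional invariant under a set of linear maps whose only common invariant covector is `0` has zero first jet.

WHAT (all [folklore]):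
§1 `log_abs_mul₃` (`log|s·a·b| = log|s| + log|a| + log|b|` for nonzero reals); **`logZ_fubini_of_det_factorisation`**: if `(F₂ B).kkt.det = s·(G B).kkt.det·(Fs B).kkt.det`
   for `B` near `0` with `s ≠ 0` and the two factors nonvanishing near `0`, then `F₂.logZ =ᶠ[𝓝 0] G.logZ + Fs.logZ + c` with the EXPLICIT constant
   `c = ((n₂ − m₂) − (n₁ − m₁) − (ns − ms))/2 · log 2π − ½·log|s|`.
§2 **`polarization_comp_eq_of_det_factorisation`**: §1 + «`G.logZ =ᶠ F₁.logZ ∘ U`» + K-U2b ⟹ the telescoping formula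
   `polarization F₂ i j = Σ_a Σ_b (∂_i U_a ∂_j U_b)·polarization F₁ a b + polarization Fs i j + Σ_a (∂_i∂_j U_a)·∂_a(F₁.logZ)(0)`;
   **`polarization_comp_eq_of_det_factorisation_tadpoleFree`**.
§3 **`fderiv_eq_zero_of_invariant`**: `f ∘ g = f` for all `g ∈ S` (continuous linear maps) and «every covector with `ℓ ∘ g = ℓ ∀ g ∈ S` is `0`» ⟹ `fderiv ℝ f 0 = 0`.
Provenance: β sub-cell, unit beta-an2 gen 23 (prover-b2b-balaban-beta-an2-g23-0), 2026-08-20.  NOT (SDF), NOT D1, NOT `BetaPertH`, NOT continuum, NOT Clay.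
-/

open Filter Topology Finset
open scoped BigOperators
open Literature.MathematicalPhysics.QuantumFieldTheory.Balaban1983to89.Beta (hessianAt polarization Family ConstrainedGaussian)
open Summit.QuantumFields.BalabanUV.Beta.PolarizationComposite (polarization_comp_eq)

namespace Summit.QuantumFields.BalabanUV.Beta.PolarizationFubini

/-! ## §1 `logZ` Fubini from a determinant factorisation -/

/-- [folklore] `log|s·a·b| = log|s| + log|a| + log|b|` for nonzero reals. -/
theorem log_abs_mul₃ {s a b : ℝ} (hs : s ≠ 0) (ha : a ≠ 0) (hb : b ≠ 0) :
    Real.log |s * a * b| = Real.log |s| + Real.log |a| + Real.log |b| := by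
  rw [abs_mul, abs_mul, Real.log_mul (mul_ne_zero (abs_ne_zero.2 hs) (abs_ne_zero.2 ha)) (abs_ne_zero.2 hb),
    Real.log_mul (abs_ne_zero.2 hs) (abs_ne_zero.2 ha)]

section Families

variable {ι κ : Type*} [Fintype ι] [DecidableEq ι] [Fintype κ] [DecidableEq κ]
variable {n₁ m₁ n₂ m₂ ns ms ng mg : ℕ}

omit [Fintype ι] [DecidableEq ι] in
/-- [folklore] **`logZ` FUBINI FROM A DETERMINANT FACTORISATION.**  If the bordered determinants of three background families factor as
`det kkt₂(B) = s · det kkt_G(B) · det kkt_s(B)` for `B` near `0`, with `s ≠ 0` and the two factors nonvanishing near `0`, then the one-loop functionals ADD: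
`F₂.logZ B = G.logZ B + Fs.logZ B + c` near `0`, `c = ((n₂ − m₂) − (ng − mg) − (ns − ms))/2 · log 2π − ½·log|s|`. -/
theorem logZ_fubini_of_det_factorisation (F₂ : Family ι n₂ m₂) (G : Family ι ng mg) (Fs : Family ι ns ms) {s : ℝ} (hs : s ≠ 0)
    (hdet : ∀ᶠ B in 𝓝 (0 : ι → ℝ), (F₂ B).kkt.det = s * (G B).kkt.det * (Fs B).kkt.det)
    (hG : ∀ᶠ B in 𝓝 (0 : ι → ℝ), (G B).kkt.det ≠ 0) (hFs : ∀ᶠ B in 𝓝 (0 : ι → ℝ), (Fs B).kkt.det ≠ 0) :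
    F₂.logZ =ᶠ[𝓝 0] fun B => G.logZ B + Fs.logZ B
      + ((((n₂ : ℝ) - m₂) - ((ng : ℝ) - mg) - ((ns : ℝ) - ms)) / 2 * Real.log (2 * Real.pi) - (1 / 2 : ℝ) * Real.log |s|) := by
  filter_upwards [hdet, hG, hFs] with B hB hGB hFsB
  simp only [Family.logZ, ConstrainedGaussian.logZ]
  rw [hB, log_abs_mul₃ hs hGB hFsB]
  ring

/-! ## §2 The telescoping of polarizations from a determinant factorisation -/

/-- [folklore] **POLARIZATION TELESCOPING FROM A DETERMINANT FACTORISATION** (route (O3) at finite volume, all analytic content as hypotheses):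
determinant factorisation near `0` (§1) + «the fine one-shot functional factors through the step minimiser», `G.logZ =ᶠ[𝓝 0] F₁.logZ ∘ U` (`U 0 = 0`,
`U` C² at `0`) + `C²` entries and nonsingular bordered matrices at the base points ⟹
`polarization F₂ i j = Σ_a Σ_b (∂_i U_a · ∂_j U_b) · polarization F₁ a b + polarization Fs i j + Σ_a (∂_i∂_j U_a) · ∂_a(F₁.logZ)(0)`. -/
theorem polarization_comp_eq_of_det_factorisation (F₂ : Family ι n₂ m₂) (G : Family ι ng mg) (F₁ : Family κ n₁ m₁)
    (Fs : Family ι ns ms) {U : (ι → ℝ) → (κ → ℝ)} {s : ℝ} (hs : s ≠ 0)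
    (hdet : ∀ᶠ B in 𝓝 (0 : ι → ℝ), (F₂ B).kkt.det = s * (G B).kkt.det * (Fs B).kkt.det)
    (hGU : G.logZ =ᶠ[𝓝 0] fun B => F₁.logZ (U B)) (hU0 : U 0 = 0) (hU : ContDiffAt ℝ 2 U 0)
    (hQG : ∀ a b, ContDiffAt ℝ 2 (fun B => (G B).Q a b) 0) (hΔG : ∀ a b, ContDiffAt ℝ 2 (fun B => (G B).Δ a b) 0)
    (hdetG : (G 0).kkt.det ≠ 0)
    (hQ₁ : ∀ a b, ContDiffAt ℝ 2 (fun B => (F₁ B).Q a b) 0) (hΔ₁ : ∀ a b, ContDiffAt ℝ 2 (fun B => (F₁ B).Δ a b) 0)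
    (hdet₁ : (F₁ 0).kkt.det ≠ 0)
    (hQs : ∀ a b, ContDiffAt ℝ 2 (fun B => (Fs B).Q a b) 0) (hΔs : ∀ a b, ContDiffAt ℝ 2 (fun B => (Fs B).Δ a b) 0)
    (hdets : (Fs 0).kkt.det ≠ 0) (i j : ι) :
    polarization F₂ i j =
      (∑ a, ∑ b, (fderiv ℝ U 0 (Pi.single i 1) a * fderiv ℝ U 0 (Pi.single j 1) b) * polarization F₁ a b)
        + polarization Fs i j
        + ∑ a, fderiv ℝ (fderiv ℝ U) 0 (Pi.single i 1) (Pi.single j 1) a * fderiv ℝ F₁.logZ 0 (Pi.single a 1) := by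
  -- nonvanishing of the two factors near `0` from continuity of the determinants
  have hcG : ContinuousAt (fun B => (G B).kkt.det) 0 := (G.contDiffAt_det_kkt hQG hΔG).continuousAt
  have hcs : ContinuousAt (fun B => (Fs B).kkt.det) 0 := (Fs.contDiffAt_det_kkt hQs hΔs).continuousAt
  have hG : ∀ᶠ B in 𝓝 (0 : ι → ℝ), (G B).kkt.det ≠ 0 := hcG.eventually_ne hdetG
  have hFs : ∀ᶠ B in 𝓝 (0 : ι → ℝ), (Fs B).kkt.det ≠ 0 := hcs.eventually_ne hdets
  have hfub0 := logZ_fubini_of_det_factorisation F₂ G Fs hs hdet hG hFs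
  have hfub : F₂.logZ =ᶠ[𝓝 0] fun B => F₁.logZ (U B) + Fs.logZ B
      + ((((n₂ : ℝ) - m₂) - ((ng : ℝ) - mg) - ((ns : ℝ) - ms)) / 2 * Real.log (2 * Real.pi) - (1 / 2 : ℝ) * Real.log |s|) := by
    filter_upwards [hfub0, hGU] with B hB hB'
    rw [hB, hB']
  exact polarization_comp_eq F₂ F₁ Fs hfub hU0 hU hQ₁ hΔ₁ hdet₁ hQs hΔs hdets i j

/-- [folklore] **THE SAME, TADPOLE-FREE**: with `fderiv ℝ F₁.logZ 0 = 0` the polarizations telescope EXACTLY —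
`polarization F₂ i j = Σ_a Σ_b (∂_i U_a · ∂_j U_b) · polarization F₁ a b + polarization Fs i j`. -/
theorem polarization_comp_eq_of_det_factorisation_tadpoleFree (F₂ : Family ι n₂ m₂) (G : Family ι ng mg)
    (F₁ : Family κ n₁ m₁) (Fs : Family ι ns ms) {U : (ι → ℝ) → (κ → ℝ)} {s : ℝ} (hs : s ≠ 0)
    (hdet : ∀ᶠ B in 𝓝 (0 : ι → ℝ), (F₂ B).kkt.det = s * (G B).kkt.det * (Fs B).kkt.det)
    (hGU : G.logZ =ᶠ[𝓝 0] fun B => F₁.logZ (U B)) (hU0 : U 0 = 0) (hU : ContDiffAt ℝ 2 U 0)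
    (hQG : ∀ a b, ContDiffAt ℝ 2 (fun B => (G B).Q a b) 0) (hΔG : ∀ a b, ContDiffAt ℝ 2 (fun B => (G B).Δ a b) 0)
    (hdetG : (G 0).kkt.det ≠ 0)
    (hQ₁ : ∀ a b, ContDiffAt ℝ 2 (fun B => (F₁ B).Q a b) 0) (hΔ₁ : ∀ a b, ContDiffAt ℝ 2 (fun B => (F₁ B).Δ a b) 0)
    (hdet₁ : (F₁ 0).kkt.det ≠ 0)
    (hQs : ∀ a b, ContDiffAt ℝ 2 (fun B => (Fs B).Q a b) 0) (hΔs : ∀ a b, ContDiffAt ℝ 2 (fun B => (Fs B).Δ a b) 0)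
    (hdets : (Fs 0).kkt.det ≠ 0) (htad : fderiv ℝ F₁.logZ 0 = 0) (i j : ι) :
    polarization F₂ i j =
      (∑ a, ∑ b, (fderiv ℝ U 0 (Pi.single i 1) a * fderiv ℝ U 0 (Pi.single j 1) b) * polarization F₁ a b)
        + polarization Fs i j := by
  rw [polarization_comp_eq_of_det_factorisation F₂ G F₁ Fs hs hdet hGU hU0 hU hQG hΔG hdetG hQ₁ hΔ₁ hdet₁ hQs hΔs hdets,
    htad]
  simp

end Families

/-! ## §3 Tadpole-freeness from invariance -/

/-- [folklore] **NO INVARIANT COVECTOR ⟹ NO FIRST JET.**  If `f` is differentiable at `0`, invariant under every `g ∈ S` (continuous linear maps,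
`f (g x) = f x`), and the only covector `ℓ` with `ℓ ∘ g = ℓ` for all `g ∈ S` is `0`, then `fderiv ℝ f 0 = 0`.  (Mechanism of tadpole-freeness:
in the genuine theory `S` = the constant gauge rotations of the background, and an invariant vector of the adjoint representation of a semisimple
group is `0`.) -/
theorem fderiv_eq_zero_of_invariant {E : Type*} [NormedAddCommGroup E] [NormedSpace ℝ E] {f : E → ℝ} (hf : DifferentiableAt ℝ f 0)
    (S : Set (E →L[ℝ] E)) (hinv : ∀ g ∈ S, ∀ x, f (g x) = f x)
    (hfix : ∀ ℓ : E →L[ℝ] ℝ, (∀ g ∈ S, ℓ.comp g = ℓ) → ℓ = 0) :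
    fderiv ℝ f 0 = 0 := by
  refine hfix _ fun g hg => ?_
  have hfg : (fun x => f (g x)) = f := funext (hinv g hg)
  have hg0 : g 0 = 0 := map_zero g
  have hf' : DifferentiableAt ℝ f (g 0) := by rw [hg0]; exact hf
  have hchain : fderiv ℝ (fun x => f (g x)) 0 = (fderiv ℝ f (g 0)).comp (fderiv ℝ (⇑g) 0) :=
    fderiv_comp 0 hf' g.differentiableAt
  rw [hfg, hg0, ContinuousLinearMap.fderiv] at hchain
  exact hchain.symm

end Summit.QuantumFields.BalabanUV.Beta.PolarizationFubini
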